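import Summits.AtomisticToContinuum.HydrodynamicLimit.Theorems.ImplosionDichotomyPolynomialCompressionPcStep
import Summits.AtomisticToContinuum.HydrodynamicLimit.Theorems.ImplosionDichotomyPolynomialCompressionPcBoot
import Summits.AtomisticToContinuum.HydrodynamicLimit.Theorems.ImplosionDichotomyPolynomialCompressionPcSetting
import Summits.AtomisticToContinuum.HydrodynamicLimit.Theorems.ImplosionDichotomyPolynomialCompressionLevel0Contract
import Summits.AtomisticToContinuum.HydrodynamicLimit.Theorems.ImplosionDichotomyPolynomialCompressionLevel3Contract
import Summits.AtomisticToContinuum.HydrodynamicLimit.Theorems.ImplosionDichotomyPolynomialCompressionInterpolationLevels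
import Summits.AtomisticToContinuum.HydrodynamicLimit.Theorems.ImplosionDichotomyPolynomialCompressionCloseSmallness
import Summits.AtomisticToContinuum.HydrodynamicLimit.Theorems.ImplosionDichotomyPolynomialCompressionCloseEnvelope
import Summits.AtomisticToContinuum.HydrodynamicLimit.Theorems.ImplosionDichotomyPolynomialCompressionEosBounds
import Summits.AtomisticToContinuum.HydrodynamicLimit.Theorems.ImplosionDichotomyPolynomialCompressionEosBoundsHigher

/-!
# Closing of stub 4: `stub_logBudgetShadowing` (line `log-lipschitz-budget`)

The lever of the line `log-lipschitz-budget` of the crux `ImplosionDichotomy.PolynomialCompression`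
(stmt-AtomisticToContinuum-12587): the polynomial-loss shadowing estimate `stub_logBudgetShadowing` of the registered
skeleton, assembled from the contracts `level0_contract` (`L0`), `shadow_interpolation_levels` (in place of `L1, L2`),
`level3_contract` (`L3`), the Sobolev and improvement lemmas `lbClose_sup_bounds`, `lbClose_step`, the smallness
package `lbClose_smallness`, the envelope `lbClose_reference_envelope`, the final bounds `lbClose_final_bounds`, the
improvement step `pcClose_step`, the continuous induction `pcClose_bootstrap`, the setting `pcClose_setting` and the
initial bounds `pcClose_initial`. The packing fraction is controlled by an outer continuous induction on `[0, T)`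
(one quantity, `sup_x σ³ρ` against `η_s/2`), inside which the setting holds on an extended interval `[0, t')` and the
inner induction `pcClose_bootstrap` runs.
-/

noncomputable section

namespace Summit.AtomisticToContinuum.HydrodynamicLimit.Theorems

open Set MeasureTheory Filter Topology
open scoped ContDiff ENNReal
open Literature.MathematicalPhysics.KineticTheory Literature.Analysis.FunctionSpaces

/-- The sup norm of a jointly smooth scalar field as an abstract continuous dominating function.
[folklore] -/
private theorem pcRun_sup_pkg {T' : ℝ} {φ : ℝ → T3 → ℝ} (h : Torus.IsSmoothSpaceTimeOn (Ico 0 T') φ) :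
    ∃ g : ℝ → ℝ, ContinuousOn g (Ico 0 T') ∧ (∀ s ∈ Ico 0 T', ∀ x, |φ s x| ≤ g s) ∧
      ∀ (s M : ℝ), 0 ≤ M → (∀ x, |φ s x| ≤ M) → g s ≤ M :=
  ⟨_, shadow_sup_continuous h⟩

/-- **The level constants of the close.** Given the level-0 constants `Q₀, b₀`, the level-3 contract constants
`β, c₀`, the weight-ratio constant `W₀`, the envelope exponent `q_e` and the initial constants `Q_init,k`, a choice
of `Q₁, b₁, Q₂, b₂, Q₃, b₃, p_w, q_s` satisfying every algebraic relation used by `pcClose_step` and by the run.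
[folklore] -/
theorem pcClose_constants :
    ∀ (Q₀ b₀ β c₀ W₀ qe Qi1 Qi2 Qi3 : ℝ), 0 ≤ Q₀ → 0 ≤ b₀ → 0 ≤ β → 0 ≤ c₀ → 0 ≤ W₀ → 0 ≤ qe → 0 ≤ Qi1 →
      0 ≤ Qi2 → 0 ≤ Qi3 →
      ∃ Q₁ b₁ Q₂ b₂ Q₃ b₃ pw qs : ℝ, Q₀ ≤ Q₁ ∧ Q₁ ≤ Q₂ ∧ 0 ≤ Q₃ ∧ b₀ ≤ b₁ ∧ b₁ ≤ b₂ ∧ b₂ ≤ b₃ ∧ b₃ ≤ qs ∧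
        qe ≤ qs ∧ 6 * qe ≤ pw ∧ Real.sqrt 3 * W₀ * Q₀ * Q₂ ≤ Q₁ ^ 2 ∧ 2 * Real.sqrt 3 * W₀ * Q₁ * Q₃ ≤ Q₂ ^ 2 ∧
        pw + b₀ + b₂ ≤ 2 * b₁ ∧ pw + b₁ + b₃ ≤ 2 * b₂ ∧ 0 < Q₁ ∧ 0 < Q₂ ∧ 0 < Q₃ ∧ Qi1 ≤ Q₁ ∧ Qi2 ≤ Q₂ ∧
        Qi3 ≤ Q₃ ∧ β * (1 + 2 * Q₂) ≤ Q₃ ∧ b₃ = b₂ + c₀ := by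
  intro Q₀ b₀ β c₀ W₀ qe Qi1 Qi2 Qi3 hQ₀ hb₀ hβ hc₀ hW₀ hqe hQi1 hQi2 hQi3
  have hs3 : 0 ≤ Real.sqrt 3 := Real.sqrt_nonneg 3
  obtain ⟨β', hβ'⟩ : ∃ β' : ℝ, β' = β + Qi3 + 1 := ⟨_, rfl⟩
  have hβ'0 : 1 ≤ β' := by rw [hβ']; linarith
  obtain ⟨s, hs⟩ : ∃ s : ℝ, s = Real.sqrt 3 * W₀ * Q₀ := ⟨_, rfl⟩
  have hs0 : 0 ≤ s := by rw [hs]; positivity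
  obtain ⟨Q₁, hQ₁⟩ : ∃ Q₁ : ℝ, Q₁ = 72 * W₀ ^ 2 * β' * Q₀ + 3 * s + 3 + Q₀ + Qi1 + Qi2 := ⟨_, rfl⟩
  have hA0 : 0 ≤ 72 * W₀ ^ 2 * β' * Q₀ := by have := hβ'0; positivity
  have hQ₁3 : 3 ≤ Q₁ := by rw [hQ₁]; linarith
  have hQ₁0 : 0 ≤ Q₁ := by linarith
  obtain ⟨a, ha⟩ : ∃ a : ℝ, a = 2 * Real.sqrt 3 * W₀ * β' * Q₁ := ⟨_, rfl⟩
  have ha0 : 0 ≤ a := by rw [ha]; have := hβ'0; positivity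
  obtain ⟨Q₂, hQ₂⟩ : ∃ Q₂ : ℝ, Q₂ = 4 * a + Q₁ + 1 := ⟨_, rfl⟩
  have hQ₂1 : 1 ≤ Q₂ := by rw [hQ₂]; linarith
  have hQ₁₂ : Q₁ ≤ Q₂ := by rw [hQ₂]; linarith
  obtain ⟨Q₃, hQ₃⟩ : ∃ Q₃ : ℝ, Q₃ = β' * (1 + 2 * Q₂) := ⟨_, rfl⟩
  have hQ₃1 : β' ≤ Q₃ := by
    rw [hQ₃]; nlinarith
  refine ⟨Q₁, 2 * (6 * qe) + b₀ + c₀, Q₂, 6 * qe + (2 * (6 * qe) + b₀ + c₀) + c₀, Q₃,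
    6 * qe + (2 * (6 * qe) + b₀ + c₀) + c₀ + c₀, 6 * qe, 6 * qe + (2 * (6 * qe) + b₀ + c₀) + c₀ + c₀ + qe,
    by rw [hQ₁]; linarith, hQ₁₂, by linarith, by linarith, by linarith, by linarith, by linarith, by linarith,
    le_rfl, ?_, ?_, by linarith, by linarith, by linarith, by linarith, by linarith, by rw [hQ₁]; linarith,
    by rw [hQ₂]; linarith, ?_, ?_, rfl⟩
  · -- `√3 W₀ Q₀ Q₂ ≤ Q₁²`
    rw [← hs, hQ₂]
    have hP0 : 0 ≤ W₀ ^ 2 * β' * Q₀ := by have := hβ'0; positivity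
    have h1 : s * (4 * a) ≤ Q₁ * (72 * W₀ ^ 2 * β' * Q₀) := by
      rw [hs, ha]
      have e : Real.sqrt 3 * W₀ * Q₀ * (4 * (2 * Real.sqrt 3 * W₀ * β' * Q₁)) =
          Q₁ * (8 * (Real.sqrt 3) ^ 2 * (W₀ ^ 2 * β' * Q₀)) := by ring
      rw [e, Real.sq_sqrt (by norm_num : (0 : ℝ) ≤ 3)]
      exact mul_le_mul_of_nonneg_left (by linarith) hQ₁0
    have h2 : s * Q₁ ≤ Q₁ * (3 * s) := by nlinarith [mul_nonneg hs0 hQ₁0]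
    have h3 : s * 1 ≤ Q₁ * 3 := by rw [hQ₁]; linarith
    have h4 : Q₁ * (72 * W₀ ^ 2 * β' * Q₀) + Q₁ * (3 * s) + Q₁ * 3 ≤ Q₁ ^ 2 := by
      have e2 : Q₁ * (72 * W₀ ^ 2 * β' * Q₀) + Q₁ * (3 * s) + Q₁ * 3 = Q₁ ^ 2 - Q₁ * (Q₀ + Qi1 + Qi2) := by
        have h5 : 72 * W₀ ^ 2 * β' * Q₀ + 3 * s + 3 = Q₁ - (Q₀ + Qi1 + Qi2) := by rw [hQ₁]; ring
        calc Q₁ * (72 * W₀ ^ 2 * β' * Q₀) + Q₁ * (3 * s) + Q₁ * 3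
            = Q₁ * (72 * W₀ ^ 2 * β' * Q₀ + 3 * s + 3) := by ring
          _ = Q₁ * (Q₁ - (Q₀ + Qi1 + Qi2)) := by rw [h5]
          _ = Q₁ ^ 2 - Q₁ * (Q₀ + Qi1 + Qi2) := by ring
      rw [e2]
      linarith [mul_nonneg hQ₁0 (show 0 ≤ Q₀ + Qi1 + Qi2 by linarith)]
    linarith [h1, h2, h3, h4]
  · -- `2√3 W₀ Q₁ Q₃ ≤ Q₂²`
    rw [hQ₃]
    have e : 2 * Real.sqrt 3 * W₀ * Q₁ * (β' * (1 + 2 * Q₂)) = a * (1 + 2 * Q₂) := by rw [ha]; ring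
    rw [e]
    calc a * (1 + 2 * Q₂) ≤ a * (4 * Q₂) := mul_le_mul_of_nonneg_left (by linarith) ha0
      _ = (4 * a) * Q₂ := by ring
      _ ≤ Q₂ * Q₂ := mul_le_mul_of_nonneg_right (by rw [hQ₂]; linarith) (by linarith)
      _ = Q₂ ^ 2 := by ring
  · have h1 : Qi3 ≤ β' := by rw [hβ']; linarith
    exact h1.trans hQ₃1
  · rw [hQ₃]; exact mul_le_mul_of_nonneg_right (by rw [hβ']; linarith) (by linarith)

/-- **`stub_logBudgetShadowing`** — the lever of the line `log-lipschitz-budget` (registered skeleton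
`Lines/log-lipschitz-budget.lean` of the crux): polynomial-loss shadowing of the Type-I isentropic ideal
implosion by the hard-sphere Euler solutions with the perturbed activity data, down to the time `T₁ - σ^e/2`,
with `(M, η)`-bounds and `ρ₁ ≤ 2ρ`. See the module docstring for the assembly. [folklore] -/
theorem stub_logBudgetShadowing :
    ∀ η₀ : ℝ, 0 < η₀ → ∀ F : ℝ → ℝ, AnalyticOnNhd ℝ F (Ioo (-η₀) η₀) → EqOn hsExcessFreeEnergy F (Ico 0 η₀) →
      F 0 = 0 → deriv F 0 = 2 * Real.pi / 3 →
      ∀ (β₀ θ₀ : T3 → ℝ) (u₀ : T3 → V3) (T₁ K : ℝ) (ρ₁ θ₁ : ℝ → T3 → ℝ) (u₁ : ℝ → T3 → V3),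
        0 < T₁ → 0 < K → IsHardSphereEulerSolution 0 T₁ ρ₁ u₁ θ₁ → (∀ x, ρ₁ 0 x = β₀ x) → u₁ 0 = u₀ →
        θ₁ 0 = θ₀ → (∀ t ∈ Ico 0 T₁, ∀ x, θ₁ t x = K * ρ₁ t x ^ (2 / 3 : ℝ)) →
        (∃ C : ℝ, ∀ t ∈ Ico 0 T₁, ∀ x, ∀ i : Fin 3, ‖Torus.partialDeriv i (u₁ t) x‖ ≤ C / (T₁ - t) ∧
          |Torus.partialDeriv i (fun y => ρ₁ t y ^ (1 / 3 : ℝ)) x| ≤ C / (T₁ - t)) →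
        (∀ n : ℕ, n ≤ 6 → ∃ Cn pn : ℝ, ∀ t ∈ Ico 0 T₁, ∀ y : EuclideanSpace ℝ (Fin 3),
          ‖iteratedFDeriv ℝ n (Torus.lift (ρ₁ t)) y‖ ≤ Cn * (T₁ - t) ^ (-pn) ∧
          ‖iteratedFDeriv ℝ n (Torus.lift (u₁ t)) y‖ ≤ Cn * (T₁ - t) ^ (-pn)) →
        (∃ cl pl : ℝ, 0 < cl ∧ ∀ t ∈ Ico 0 T₁, ∀ x, cl * (T₁ - t) ^ pl ≤ ρ₁ t x) →
        ∀ (ρs : ℝ → T3 → ℝ) (σ₁ : ℝ), 0 < σ₁ → (∀ σ : ℝ, 0 < σ → σ < σ₁ → Torus.IsSmooth (ρs σ) ∧ ∀ x, 0 < ρs σ x) →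
        (∀ n : ℕ, ∃ Cn : ℝ, ∀ σ : ℝ, 0 < σ → σ < σ₁ → ∀ y : EuclideanSpace ℝ (Fin 3),
          ‖iteratedFDeriv ℝ n (Torus.lift (fun x => ρs σ x - β₀ x)) y‖ ≤ Cn * σ ^ 3) →
        ∀ η : ℝ, 0 < η →
        ∃ e : ℝ, 0 < e ∧ ∃ σ₂ : ℝ, 0 < σ₂ ∧ σ₂ ≤ σ₁ ∧ ∀ σ : ℝ, 0 < σ → σ < σ₂ →
          σ ^ e < T₁ ∧ (∀ x, ρs σ x * σ ^ 3 ≤ η) ∧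
          ∃ M : ℝ, 0 < M ∧ ∀ T : ℝ, T ≤ T₁ - σ ^ e / 2 →
            ∀ (ρ θ : ℝ → T3 → ℝ) (u : ℝ → T3 → V3), IsHardSphereEulerSolution σ T ρ u θ →
            ρ 0 = ρs σ → u 0 = u₀ → θ 0 = θ₀ →
            ∀ t ∈ Ico 0 T, ∀ x,
              (M⁻¹ ≤ ρ t x ∧ ρ t x ≤ M ∧ M⁻¹ ≤ θ t x ∧ θ t x ≤ M ∧ ‖u t x‖ ≤ M ∧ ρ t x * σ ^ 3 ≤ η ∧
                ∀ i : Fin 3, ‖Torus.partialDeriv i (u t) x‖ ≤ M ∧ |Torus.partialDeriv i (ρ t) x| ≤ M ∧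
                  |Torus.partialDeriv i (θ t) x| ≤ M) ∧
              ρ₁ t x ≤ 2 * ρ t x := by
  intro η₀ hη₀ F hF hFeq _hF0 _hF'0 β₀ θ₀ u₀ T₁ K ρ₁ θ₁ u₁ hT₁ hK hE₁ hρ₁0 hu₁0 hθ₁0 hIsen hTypeI hpoly hfloor ρs σ₁ hσ₁
    _hρs hstat η hη
  -- the constants of the problem
  obtain ⟨C, hC⟩ := hTypeI
  have hTI : ∀ t ∈ Ico 0 T₁, ∀ x, ∀ i : Fin 3, ‖Torus.partialDeriv i (u₁ t) x‖ ≤ max C 0 / (T₁ - t) ∧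
      |Torus.partialDeriv i (fun y => ρ₁ t y ^ (1 / 3 : ℝ)) x| ≤ max C 0 / (T₁ - t) := by
    intro t ht x i
    have hl : 0 ≤ T₁ - t := by linarith [ht.2]
    have hm : C / (T₁ - t) ≤ max C 0 / (T₁ - t) := div_le_div_of_nonneg_right (le_max_left _ _) hl
    exact ⟨((hC t ht x i).1).trans hm, ((hC t ht x i).2).trans hm⟩
  have hC0 : 0 ≤ max C 0 := le_max_right _ _
  obtain ⟨Cpoly, ppoly, hCpoly, hpolyB⟩ := lbClose_poly_choice hpoly
  obtain ⟨cl, pl, hcl, hfl⟩ := hfloor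
  obtain ⟨Cstat, hCstat, hstatB, hChB⟩ := lbClose_stat_choice hstat
  obtain ⟨η₂, cZ₁, hη₂, hη₂₀, hcZ₁, hEos⟩ := hsEos_rescaled_bounds η₀ hη₀ F hF hFeq
  obtain ⟨η₃, cZ₂, hη₃, -, hcZ₂, hEosH⟩ := hsEos_rescaled_bounds_higher η₀ hη₀ F hF
  obtain ⟨cZ, ηs, hc1, hc2, hcZ, hηs, hηsη, h2η₂, h2η₃, hηs8, hcZηs⟩ :=
    lbClose_eta_choice η η₂ η₃ cZ₁ cZ₂ hη hη₂ hη₃ hcZ₁ hcZ₂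
  obtain ⟨r, R, pl', pu', hr, hr1, hR, hpl', hpu', henv⟩ :=
    lbClose_reference_envelope T₁ cl pl (Cpoly 0) (ppoly 0) hT₁ hcl
  have henvT := henv (T := T₁) le_rfl hE₁.density_pos hfl (hpolyB 0 (by norm_num))
  obtain ⟨Q₀, b₀, hQ₀, hb₀, hL0⟩ := level0_contract K (max C 0) 1 cZ T₁ cl pl Cpoly ppoly Cstat hK hC0 zero_le_one
    hcZ hT₁ hcl hCpoly hCstat
  obtain ⟨β, c₀, hβ, hc₀, hL3⟩ := level3_contract K (max C 0) cZ T₁ cl pl Cpoly ppoly Cstat hK hC0 hcZ hT₁ hcl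
    hCpoly hCstat
  obtain ⟨KS, hKS, hSup⟩ := lbClose_sup_bounds
  obtain ⟨KT, hKT, hStep⟩ := lbClose_step
  -- the level constants
  set Ch : ℝ := Cstat 0 + Cstat 1 + Cstat 2 + Cstat 3 with hChdef
  have hCh0 : 0 ≤ Ch := by
    have := hCstat 0; have := hCstat 1; have := hCstat 2; have := hCstat 3; positivity
  set mK : ℝ := min (K / (4 * R)) (min (r ^ 3 / 2) (r / (2 * K))) with hmKdef
  have hmK : 0 < mK := lt_min (by positivity) (lt_min (by positivity) (by positivity))
  set W₀ : ℝ := max (4 * K / r) (max (3 / 2 * R ^ 3) (9 / 2 * R / K)) / mK with hW₀def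
  have hW₀ : 0 ≤ W₀ := div_nonneg (le_trans (by positivity) (le_max_left _ _)) hmK.le
  obtain ⟨Q₁, b₁, Q₂, b₂, Q₃, b₃, pw, qs, hQ01, hQ12, hQ₃, hb01, hb12, hb23, hb3qs, hqes, hpw, hI12, hI23, hbI1,
      hbI2, hQ₁p, hQ₂p, hQ₃p, hQi1, hQi2, hQi3, hQ₃β, hb₃⟩ :=
    pcClose_constants Q₀ b₀ β c₀ W₀ (pl' + pu') (Cstat 1 * Real.sqrt (3 * (4 * K / r) / 2))
      (Cstat 2 * Real.sqrt (9 * (4 * K / r) / 2)) (Cstat 3 * Real.sqrt (27 * (4 * K / r) / 2)) hQ₀ hb₀ hβ hc₀ hW₀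
      (by positivity) (by have := hCstat 1; positivity) (by have := hCstat 2; positivity)
      (by have := hCstat 3; positivity)
  have hqe : 0 ≤ pl' + pu' := by positivity
  have hqs : 0 ≤ qs := hqe.trans hqes
  have hQ₁ : 0 ≤ Q₁ := hQ₀.trans hQ01
  have hQ₂ : 0 ≤ Q₂ := hQ₁.trans hQ12
  set Qh : ℝ := Q₀ + 2 * Q₁ + 2 * Q₂ + 2 * Q₃ with hQhdef
  have hQh : 0 ≤ Qh := by positivity
  set QS : ℝ := 15 * Real.sqrt (KS * mK⁻¹ * 6) * Qh with hQSdef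
  have hQS : 0 ≤ QS := by positivity
  obtain ⟨N, hN, hL3N⟩ := hL3 (2 * Q₂) b₂ QS (3 * qs) (by positivity) (hb₀.trans (hb01.trans hb12)) hQS
    (by positivity)
  obtain ⟨e, he, he1, σ₀, hσ₀, hσ₀1, hsmall⟩ := lbClose_smallness KT K r R Qh T₁ ηs Ch (QS + 1) (max qs N) hKT hK
    hr hr1 hR hQh hT₁ hηs hCh0 (by positivity) (hqs.trans (le_max_left _ _))
  refine ⟨e, he, min σ₀ σ₁, lt_min hσ₀ hσ₁, min_le_right _ _, fun σ hσ hσ₂ => ?_⟩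
  have hσσ₀ : σ < σ₀ := hσ₂.trans_le (min_le_left _ _)
  have hσσ₁ : σ < σ₁ := hσ₂.trans_le (min_le_right _ _)
  have hσ1 : σ ≤ 1 := (hσσ₀.trans_le hσ₀1).le
  have hσ3 : 0 ≤ σ ^ 3 := by positivity
  have hσ31 : σ ^ 3 ≤ 1 := pow_le_one₀ hσ.le hσ1
  obtain ⟨hσeT, hI0a, hI0c, hI1b, hwin⟩ := hsmall σ hσ hσσ₀
  -- the envelope on `[0, T₁)` in the form of the step, and at `t = 0`
  have henvG : ∀ s ∈ Ico 0 T₁, 1 ≤ T₁ / (T₁ - s) ∧ ∀ x, r / (T₁ / (T₁ - s)) ^ (pl' + pu') ≤ ρ₁ s x ^ (1 / 3 : ℝ) ∧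
      ρ₁ s x ^ (1 / 3 : ℝ) ≤ R * (T₁ / (T₁ - s)) ^ (pl' + pu') := by
    intro s hs
    have hl : 0 < T₁ - s := by linarith [hs.2]
    have hX : 1 ≤ T₁ / (T₁ - s) := by rw [le_div_iff₀ hl]; linarith [hs.1]
    have hXq : ∀ {a : ℝ}, a ≤ pl' + pu' → (T₁ / (T₁ - s)) ^ a ≤ (T₁ / (T₁ - s)) ^ (pl' + pu') := fun ha =>
      Real.rpow_le_rpow_of_exponent_le hX ha
    have hX0 : ∀ a : ℝ, 0 < (T₁ / (T₁ - s)) ^ a := fun a => Real.rpow_pos_of_pos (by linarith) a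
    refine ⟨hX, fun x => ⟨?_, ?_⟩⟩
    · obtain ⟨h1, -, -, -⟩ := henvT s hs x
      calc r / (T₁ / (T₁ - s)) ^ (pl' + pu') ≤ r / (T₁ / (T₁ - s)) ^ pl' :=
            div_le_div_of_nonneg_left hr.le (hX0 _) (hXq (by linarith))
        _ ≤ ρ₁ s x ^ (1 / 3 : ℝ) := by rw [div_le_iff₀ (hX0 _)]; exact h1
    · obtain ⟨-, h2, -, -⟩ := henvT s hs x
      exact h2.trans (mul_le_mul_of_nonneg_left (hXq (by linarith)) (by linarith))
  have h0T₁ : (0 : ℝ) ∈ Ico 0 T₁ := ⟨le_rfl, hT₁⟩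
  have hX00 : T₁ / (T₁ - 0) = 1 := by rw [sub_zero, div_self hT₁.ne']
  have henv0 : ∀ x, r ≤ ρ₁ 0 x ^ (1 / 3 : ℝ) ∧ ρ₁ 0 x ^ (1 / 3 : ℝ) ≤ R := by
    intro x
    obtain ⟨h1, h2⟩ := (henvG 0 h0T₁).2 x
    rw [hX00, Real.one_rpow, div_one] at h1
    rw [hX00, Real.one_rpow, mul_one] at h2
    exact ⟨h1, h2⟩
  have hChB' : ∀ n : ℕ, n ≤ 3 → Cstat n ≤ Ch := hChB
  -- the data: statics at `σ`, and the packing fraction of the data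
  have hstσ : ∀ (n : ℕ) (y : EuclideanSpace ℝ (Fin 3)),
      ‖iteratedFDeriv ℝ n (Torus.lift (fun x => ρs σ x - β₀ x)) y‖ ≤ Cstat n * σ ^ 3 := fun n y => hstatB n σ hσ hσσ₁ y
  have hpack0 : ∀ x, ρs σ x * σ ^ 3 ≤ ηs / 2 := by
    intro x
    have hd : |ρs σ x - β₀ x| ≤ Ch * σ ^ 3 := by
      have h := hstσ 0 (Torus.repr x)
      rw [norm_iteratedFDeriv_zero, Torus.lift_repr, Real.norm_eq_abs] at h
      exact h.trans (mul_le_mul_of_nonneg_right (hChB' 0 (by norm_num)) hσ3)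
    obtain ⟨hc, hρ₁c, -, -⟩ := isentropic_pointwise_algebra hK (hE₁.density_pos 0 h0T₁ x) (hIsen 0 h0T₁ x)
    have hβ₀ : β₀ x ≤ R ^ 3 := by
      rw [← hρ₁0 x, hρ₁c]; exact pow_le_pow_left₀ hc.le (henv0 x).2 3
    have h1 : ρs σ x ≤ R ^ 3 + Ch := by
      have h3 : Ch * σ ^ 3 ≤ Ch := by simpa using mul_le_mul_of_nonneg_left hσ31 hCh0
      linarith [(abs_le.1 hd).2]
    exact (mul_le_mul_of_nonneg_right h1 hσ3).trans hI0c
  refine ⟨hσeT, fun x => (hpack0 x).trans (by linarith), ?_⟩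
  -- the final constant `M`
  set Xb : ℝ := 2 * T₁ / σ ^ e with hXbdef
  have hσe : 0 < σ ^ e := Real.rpow_pos_of_pos hσ e
  have hXb : 0 < Xb := by positivity
  obtain ⟨M, hM, hfin⟩ := lbClose_final_bounds K (max C 0) T₁ (r / Xb ^ pl') (R * Xb ^ pu') Xb η hK hC0 hT₁
    (by positivity) (by positivity) hXb
  refine ⟨M, hM, fun T hT ρ θ u hE hρ0 hu0 hθ0 => ?_⟩
  -- the rescaled law at `σ`
  obtain ⟨ζ, J, hJo, hζs, hsol, hlow, hhigh⟩ : ∃ (ζ : ℝ → ℝ) (J : Set ℝ), IsOpen J ∧ ContDiffOn ℝ (⊤ : ℕ∞) ζ J ∧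
      (∀ (T : ℝ) (ρ θ : ℝ → T3 → ℝ) (u : ℝ → T3 → V3), IsHardSphereEulerSolution σ T ρ u θ →
        (∀ t ∈ Ico 0 T, ∀ x, ρ t x * σ ^ 3 < η₀) →
        (∀ t ∈ Ico 0 T, ∀ x, ρ t x ∈ J) ∧
        ∀ t ∈ Ico 0 T, ∀ x, hsPressure σ (ρ t x) (θ t x) = ρ t x * θ t x * ζ (ρ t x)) ∧
      (∀ r : ℝ, 0 ≤ r → r * σ ^ 3 ≤ η₂ → |ζ r - 1| ≤ cZ₁ * (r * σ ^ 3) ∧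
        |r * deriv ζ r| ≤ cZ₁ * (r * σ ^ 3) ∧ |r ^ 2 * deriv (deriv ζ) r| ≤ cZ₁ * (r * σ ^ 3)) ∧
      (∀ r : ℝ, 0 ≤ r → r * σ ^ 3 ≤ η₃ → |r ^ 3 * deriv (deriv (deriv ζ)) r| ≤ cZ₂ * (r * σ ^ 3) ∧
        |r ^ 4 * deriv (deriv (deriv (deriv ζ))) r| ≤ cZ₂ * (r * σ ^ 3)) :=
    ⟨_, _, (hEos σ hσ).1, (hEos σ hσ).2.1, (hEos σ hσ).2.2.1, (hEos σ hσ).2.2.2, hEosH σ hσ⟩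
  have hTT₁ : T ≤ T₁ := hT.trans (by linarith)
  have hu0' : u 0 = u₁ 0 := hu0.trans hu₁0.symm
  have hθ0' : θ 0 = θ₁ 0 := hθ0.trans hθ₁0.symm
  have hst' : ∀ n : ℕ, n ≤ 6 → ∀ y : EuclideanSpace ℝ (Fin 3),
      ‖iteratedFDeriv ℝ n (Torus.lift (fun x => ρ 0 x - ρ₁ 0 x)) y‖ ≤ Cstat n * σ ^ 3 := by
    have e : (fun x => ρ 0 x - ρ₁ 0 x) = fun x => ρs σ x - β₀ x := by
      funext x; rw [hρ0, hρ₁0 x]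
    intro n _ y; rw [e]; exact hstσ n y
  -- the smallness on the window `[0, T)`
  have hwinT : ∀ s ∈ Ico 0 T, σ ^ 3 * (QS + 1) * (T₁ / (T₁ - s)) ^ N ≤ 1 ∧
      (let Y := (T₁ / (T₁ - s)) ^ qs
       KT * (4 * (R * Y) / K) * (6 * (σ ^ 3 * Qh * Y) ^ 2) ≤ ((r / Y) ^ 3 / 4) ^ 2 ∧
       KT * (2 * K / (r / Y)) * (6 * (σ ^ 3 * Qh * Y) ^ 2) ≤ (K * (r / Y) ^ 2 / 4) ^ 2 ∧
       3 / 2 * (R * Y) ^ 3 * σ ^ 3 ≤ ηs / 2 ∧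
       KT * (2 / (r / Y) ^ 3) * (6 * (σ ^ 3 * Qh * Y) ^ 2) ≤ 1 ∧
       KT * (2 / (r / Y) ^ 3) * (6 * (σ ^ 3 * Qh * Y) ^ 2) ≤ (1 / (2 * T₁)) ^ 2 ∧
       K / (r / Y) ^ 4 * (KT * (4 * (R * Y) / K) * (6 * (σ ^ 3 * Qh * Y) ^ 2)) ≤ (1 / (2 * T₁)) ^ 2 ∧
       1 / (K * (r / Y) ^ 2) * (KT * (2 * K / (r / Y)) * (6 * (σ ^ 3 * Qh * Y) ^ 2)) ≤ (1 / (2 * T₁)) ^ 2) := by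
    intro s hs
    obtain ⟨-, hX, -, hY⟩ := hwin s hs.1 (by linarith [hs.2])
    have hXN : 1 ≤ (T₁ / (T₁ - s)) ^ N := Real.one_le_rpow hX hN
    have hXq : 1 ≤ (T₁ / (T₁ - s)) ^ qs := Real.one_le_rpow hX hqs
    exact ⟨(hY _ hXN (Real.rpow_le_rpow_of_exponent_le hX (le_max_right _ _))).1,
      (hY _ hXq (Real.rpow_le_rpow_of_exponent_le hX (le_max_left _ _))).2⟩
  -- the chain: packing `≤ η_s` on `[0, t]` gives the STRONG bounds at `t`
  have hchain : ∀ t ∈ Ico 0 T, (∀ s ∈ Icc 0 t, ∀ x, ρ s x * σ ^ 3 ≤ ηs) →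
      (∀ x, |ρ t x - ρ₁ t x| ≤ ρ₁ t x / 4 ∧ |θ t x - θ₁ t x| ≤ θ₁ t x / 4 ∧
          ρ t x * σ ^ 3 ≤ ηs / 2 ∧ ‖u t x - u₁ t x‖ ≤ 1 ∧
          ∀ i : Fin 3,
            ‖Torus.partialDeriv i (u t) x - Torus.partialDeriv i (u₁ t) x‖ ≤ 1 / (2 * (T₁ - t)) ∧
            Real.sqrt (θ₁ t x) * |Torus.partialDeriv i (ρ t) x - Torus.partialDeriv i (ρ₁ t) x| /
                ρ₁ t x ≤ 1 / (2 * (T₁ - t)) ∧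
            |Torus.partialDeriv i (θ t) x - Torus.partialDeriv i (θ₁ t) x| / Real.sqrt (θ₁ t x) ≤
              1 / (2 * (T₁ - t))) ∧
        Real.sqrt (shadowE1 ζ ρ θ u ρ₁ θ₁ u₁ t) ≤ σ ^ 3 * Q₁ * (T₁ / (T₁ - t)) ^ b₁ ∧
        Real.sqrt (shadowE2 ζ ρ θ u ρ₁ θ₁ u₁ t) ≤ σ ^ 3 * Q₂ * (T₁ / (T₁ - t)) ^ b₂ ∧
        Real.sqrt (shadowE3 ζ ρ θ u ρ₁ θ₁ u₁ t) ≤ σ ^ 3 * Q₃ * (T₁ / (T₁ - t)) ^ b₃ := by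
    intro t ht hpk
    obtain ⟨t', htt', ht'T, hS, hH⟩ := pcClose_setting hJo hζs hsol hlow hhigh hη₂₀ hc1 hc2 h2η₂ h2η₃ hηs hE₁ hIsen
      hTI hpolyB hfl hE hTT₁ hσ hσ1 hu0' hθ0' hst' ht hpk
    have hS' := hS
    obtain ⟨hEt, hE₁t, -, -, -, ht'T₁, -, -, hρJ, -, hEos3, hIsen', -, -, -, -, -, -⟩ := hS'
    have hsub : ∀ s ∈ Ico 0 t', s ∈ Ico 0 T := fun s hs => ⟨hs.1, hs.2.trans_le ht'T⟩
    have hsub₁ : ∀ s ∈ Ico 0 t', s ∈ Ico 0 T₁ := fun s hs => ⟨hs.1, hs.2.trans_le ht'T₁⟩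
    refine pcClose_bootstrap hEt hE₁t hJo hζs hρJ ht'T₁ hσ hηs hQ₁p hQ₂p hQ₃p
      (pcClose_initial hS hK hcZ hηs hcZηs hr hR hT₁ hCstat hChB' henv0 hI0a hI0c hI1b hQi1 hQi2 hQi3)
      (fun s hs hw hwE => ?_) t ⟨ht.1, htt'⟩
    refine pcClose_step hS hK hcZ hs hηs hηs8 hcZηs hr hr1 hR hqe hqes (fun s' hs' => henvG s' (hsub₁ s' hs')) hQ₀
      hQ01 hQ12 hQ₃ hb₀ hb01 hb12 hb23 hb3qs hW₀ hpw hI12 hI23 hbI1 hbI2 (le_refl Qh) (le_of_eq hW₀def.symm) hKS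
      (le_refl QS) (le_refl (3 * qs)) ?_ hKT ?_ (fun s' hs' => hwinT s' (hsub s' hs')) ?_ ?_ ?_ hw hwE
    · -- the Sobolev sup bounds
      intro s' mA mρ mB ℰ hs' hmA hmρ hmB hA hρm hB h0 h1 h2 h3
      exact hSup hEt hE₁t hJo hζs hρJ hs' hmA hmρ hmB hA hρm hB h0 h1 h2 h3
    · -- the improvement lemma
      intro s' L U ℰ hs' hL hL1 hU hsT₁ henvx hwk h0 h1 h2 h3 i1 i2 i3 i4 i5 i6 i7
      exact hStep hEt hE₁t hJo hζs hρJ hs' hσ hK hL hL1 hU hcZ hcZηs hT₁ hsT₁ (hIsen' s' hs') henvx hwk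
        (fun x => ⟨(hEos3 s' hs' x).1, (hEos3 s' hs' x).2.1⟩) h0 h1 h2 h3 i1 i2 i3 i4 i5 i6 i7
    · -- the level-0 contract
      intro t₀ ht₀ hw0
      exact hL0 σ t' t₀ ρ θ ρ₁ θ₁ u u₁ _ _ hS ht₀ hw0
    · -- the level-3 contract
      intro t₀ ht₀ hw0 e0 e1 e2 hsm hwn
      have h := hL3N σ t' t₀ ρ θ ρ₁ θ₁ u u₁ _ _ hS hH ht₀ hw0 e0 e1 e2 hsm hwn
      rw [← hb₃] at h
      refine shadowLevelBound_mono h hQ₃β hσ.le fun s' hs' => ?_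
      have : s' < T₁ := (hs'.2.trans_lt ht₀.2).trans_le ht'T₁
      exact (div_pos hT₁ (by linarith)).le
    · -- the interpolation
      intro s' hs' m M' hm hwts
      exact shadow_interpolation_levels hEt hE₁t hs' hJo hζs (hρJ s' hs') hm hwts
  -- the outer continuous induction on the packing fraction
  intro t ht x
  have hT0 : 0 < T := ht.1.trans_lt ht.2
  have h0T : (0 : ℝ) ∈ Ico 0 T := ⟨le_rfl, hT0⟩
  obtain ⟨gp, hcp, hdp, hlp⟩ :
      ∃ g : ℝ → ℝ, ContinuousOn g (Ico 0 T) ∧ (∀ s ∈ Ico 0 T, ∀ x, |σ ^ 3 * ρ s x| ≤ g s) ∧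
        ∀ (s M : ℝ), 0 ≤ M → (∀ x, |σ ^ 3 * ρ s x| ≤ M) → g s ≤ M :=
    pcRun_sup_pkg (isSmoothSpaceTimeOn_const_mul hE.smooth_density (σ ^ 3))
  have hgp_of : ∀ s ∈ Ico 0 T, (∀ y, ρ s y * σ ^ 3 ≤ ηs / 2) → gp s ≤ ηs / 2 := by
    intro s hs h
    refine hlp s _ (by linarith) fun y => ?_
    rw [abs_of_nonneg (mul_nonneg hσ3 (hE.density_pos s hs y).le), mul_comm]
    exact h y
  have hpk_of : ∀ s ∈ Ico 0 T, gp s ≤ 2 * (ηs / 2) → ∀ y, ρ s y * σ ^ 3 ≤ ηs := by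
    intro s hs h y
    have h1 := hdp s hs y
    rw [abs_of_nonneg (mul_nonneg hσ3 (hE.density_pos s hs y).le)] at h1
    linarith [mul_comm (ρ s y) (σ ^ 3)]
  have hrun : ∀ i : Unit, ∀ s ∈ Ico 0 T, (fun _ : Unit => gp) i s ≤ (fun (_ : Unit) (_ : ℝ) => ηs / 2) i s :=
    bootstrap_of_continuousOn (ι := Unit) (T := T) (g := fun _ => gp) (b := fun _ _ => ηs / 2)
      (fun _ => hcp) (fun _ => continuousOn_const) (fun _ s _ => by show 0 < ηs / 2; linarith)
      (fun _ => by show gp 0 ≤ ηs / 2; exact hgp_of 0 h0T fun y => by rw [hρ0]; exact hpack0 y)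
      (fun s hs hall _ => by
        show gp s ≤ ηs / 2
        have hall' : ∀ s' ∈ Icc 0 s, gp s' ≤ 2 * (ηs / 2) := fun s' hs' => hall () s' hs'
        exact hgp_of s hs fun y =>
          ((hchain s hs fun s' hs' y' => hpk_of s' ⟨hs'.1, hs'.2.trans_lt hs.2⟩ (hall' s' hs') y').1 y).2.2.1)
  have hpk : ∀ s ∈ Icc 0 t, ∀ y, ρ s y * σ ^ 3 ≤ ηs := fun s hs y => by
    have hsT : s ∈ Ico 0 T := ⟨hs.1, hs.2.trans_lt ht.2⟩
    have h : gp s ≤ ηs / 2 := hrun () s hsT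
    exact hpk_of s hsT (by linarith) y
  obtain ⟨hst, -, -, -⟩ := hchain t ht hpk
  obtain ⟨d1, d2, d3, d4, dD⟩ := hst x
  -- the final bounds
  have htT₁ : t ∈ Ico 0 T₁ := ⟨ht.1, ht.2.trans_le hTT₁⟩
  have hl : 0 < T₁ - t := by linarith [ht.2]
  have hle : σ ^ e / 2 ≤ T₁ - t := by linarith [ht.2]
  have hXle : T₁ / (T₁ - t) ≤ Xb := by
    rw [hXbdef, div_le_div_iff₀ hl hσe]
    calc T₁ * σ ^ e ≤ T₁ * (2 * (T₁ - t)) := mul_le_mul_of_nonneg_left (by linarith) hT₁.le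
      _ = 2 * T₁ * (T₁ - t) := by ring
  have hX1 : 1 ≤ T₁ / (T₁ - t) := (henvG t htT₁).1
  obtain ⟨e1, e2, -, e4⟩ := henvT t htT₁ x
  have hXp : ∀ {a : ℝ}, 0 ≤ a → (T₁ / (T₁ - t)) ^ a ≤ Xb ^ a := fun ha =>
    Real.rpow_le_rpow (by linarith) hXle ha
  have hX0 : ∀ a : ℝ, 0 < (T₁ / (T₁ - t)) ^ a := fun a => Real.rpow_pos_of_pos (by linarith) a
  have hL : r / Xb ^ pl' ≤ ρ₁ t x ^ (1 / 3 : ℝ) :=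
    calc r / Xb ^ pl' ≤ r / (T₁ / (T₁ - t)) ^ pl' := div_le_div_of_nonneg_left hr.le (hX0 _) (hXp hpl')
      _ ≤ ρ₁ t x ^ (1 / 3 : ℝ) := by rw [div_le_iff₀ (hX0 _)]; exact e1
  have hU : ρ₁ t x ^ (1 / 3 : ℝ) ≤ R * Xb ^ pu' := e2.trans (mul_le_mul_of_nonneg_left (hXp hpu') (by linarith))
  have hUu : ‖u₁ t x‖ ≤ R * Xb ^ pu' := e4.trans (mul_le_mul_of_nonneg_left (hXp hpu') (by linarith))
  have hXbT : 1 / (T₁ - t) ≤ Xb / T₁ := by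
    rw [hXbdef, div_le_div_iff₀ hl hT₁]
    have e' : 2 * T₁ / σ ^ e * (T₁ - t) = T₁ * (2 * (T₁ - t) / σ ^ e) := by ring
    rw [e', one_mul]
    have h2 : 1 ≤ 2 * (T₁ - t) / σ ^ e := by rw [le_div_iff₀ hσe]; linarith
    exact le_mul_of_one_le_right hT₁.le h2
  exact hfin hE₁ htT₁ hl hXbT hIsen hL hU hUu (hTI t htT₁ x) (by linarith [d1, abs_nonneg (ρ t x - ρ₁ t x)])
    (by linarith [d2, abs_nonneg (θ t x - θ₁ t x)]) (d3.trans (by linarith)) hηsη d4 fun i => by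
      obtain ⟨a1, a2, a3⟩ := dD i
      have h2 : 1 / (2 * (T₁ - t)) ≤ 1 / (T₁ - t) :=
        div_le_div_of_nonneg_left zero_le_one hl (by linarith)
      exact ⟨a1.trans h2, a2.trans h2, a3.trans h2⟩

end Summit.AtomisticToContinuum.HydrodynamicLimit.Theorems

end
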